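import Mathlib
import HarnessLib

/-!
# Shift-register synthesis: Massey's Theorem 1, Lemma 1, the update rule (14) and Theorem 2

Topic `Literature/InformationTheory/Coding`. The algebra behind the Berlekamp–Massey algorithm:
the length bound for linear feedback shift registers (LFSRs) generating a finite sequence, the
linear complexity profile `L_N(s)` and its exact growth law.

## Source, VERBATIM — J. L. Massey, *Shift-register synthesis and BCH decoding*,
IEEE Trans. Inform. Theory **IT-15** (1969) 122–127 [Massey1969]
(held `paper:doi-10-1109-tit-1969-1054260`, §II–§III, pp. 122–124)

§II. "A general linear feedback shift register (LFSR) of length `L` … consists of a cascade of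
`L` unit delay cells, or stages, with provision to form a linear combination of the cell contents,
which then serves as the input to the first stage. … The initial contents `s_0, s_1, …, s_{L-1}`
of the `L` stages coincide with the first `L` output digits, and the remaining output digits are
uniquely determined by the recursion `s_j = -∑_{i=1}^{L} c_i s_{j-i}`, `j = L, L+1, L+2, …`. (1)
… There is no requirement that `c_L ≠ 0` (i.e., the last stage of the LFSR need not be tapped).
An LFSR is said to generate a finite sequence `s_0, s_1, …, s_{N-1}` when this sequence coincides
with the first `N` output digits of the LFSR for some initial loading. If `L ≥ N`, the LFSR
always generates the sequence. If `L < N`, it follows from (1) that the LFSR generates the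
sequence if and only if `s_j + ∑_{i=1}^{L} c_i s_{j-i} = 0`, `j = L, L+1, …, N-1`. (2)"

"**Theorem 1.** If some LFSR of length `L` generates the sequence `s_0, s_1, …, s_{N-1}` but not
the sequence `s_0, s_1, …, s_{N-1}, s_N`, then any LFSR that generates the latter sequence has
length `L'`, satisfying `L' ≥ N + 1 - L`. (3)"

"Now let `s` denote an infinite sequence `s_0, s_1, s_2, …` … We define `L_N(s)` as the minimum
of the lengths of all the LFSR's that generate `s_0, s_1, …, s_{N-1}`. By our earlier remarks,
`L_N(s) ≤ N`. Moreover, `L_N(s)` must be monotonically nondecreasing with increasing `N`. By way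
of convention, we shall say that the all-zero sequence is generated by the LFSR with length
`L = 0`, and therefore that `L_N(s) = 0` if and only if `s_0, s_1, …, s_{N-1}` are all zeros."

"**Lemma 1.** If some LFSR of length `L_N(s)` generates `s_0, s_1, …, s_{N-1}` but not
`s_0, s_1, …, s_{N-1}, s_N`, then `L_{N+1}(s) ≥ max [L_N(s), N + 1 - L_N(s)]`.
Proof: From the monotonicity of `L_N(s)`, we have `L_{N+1}(s) ≥ L_N(s)`. Under the hypothesis of
the lemma, Theorem 1 implies that `L_{N+1}(s) ≥ N + 1 - L_N(s)`."

§III. "the connection polynomial of the LFSR … `C(D) = 1 + c_1 D + c_2 D^2 + … + c_L D^L` (8)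
which has degree at most `L` in the indeterminate `D`. By way of convention, we take `C(D) = 1`
for the LFSR of length `L = 0`. When `s_0, s_1, …, s_{N-1}` are all zeros but `s_N ≠ 0`, then
`L_{N+1}(s) = N + 1`". The proof of Theorem 2: with `d_n` "the next discrepancy" of the minimal
LFSR `C^{(n)}(D)` at `n`, and `m` "the sequence length before the last length change",
`L_m(s) < L_n(s)`, `L_{m+1}(s) = L_n(s)`, `d_m ≠ 0` (12) and, by induction,
`L_n(s) = m + 1 - L_m(s)` (13): "We now claim that the connection polynomial
`C(D) = C^{(n)}(D) - d_n d_m^{-1} D^{n-m} C^{(m)}(D)` (14) is a valid next choice for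
`C^{(n+1)}(D)`. Note first from (14) that the degree of `C(D)` is at most
`max [L_n(s), n - m + L_m(s)] = max [L_n(s), n + 1 - L_n(s)]` … Hence `C(D)` is an allowable
connection polynomial for a LFSR of length `L` where `L = max [L_n(s), n + 1 - L_n(s)]`. (15)"

"**Theorem 2.** If some LFSR of length `L_N(s)`, which generates `s_0, s_1, …, s_{N-1}`, also
generates `s_0, s_1, …, s_{N-1}, s_N`, then `L_{N+1}(s) = L_N(s)`. Conversely, if some LFSR of
length `L_N(s)` that generates `s_0, s_1, …, s_{N-1}` fails to generate
`s_0, s_1, …, s_{N-1}, s_N`, then `L_{N+1}(s) = max [L_N(s), N + 1 - L_N(s)]`."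

## What is here (over a commutative ring `K`; the update (14) and Theorem 2 over a field)

* `LFSR K` — a length `L` with a connection polynomial `C(D)`, `C(0) = 1`, `deg C ≤ L` ((8));
  `tapSum`, `LFSR.nextDiscrepancy` (`d_j = s_j + ∑_{i=1}^{L} c_i s_{j-i}`), `LFSR.GeneratesSeq`
  ((2)) and its recursion form (1) (`generatesSeq_iff_recursion`).
* `massey_theorem_1` — **Theorem 1**, as `N + 1 ≤ L + L'`; its consequence that two LFSRs with
  `L + L' ≤ N` generating `s_0, …, s_{N-1}` predict the same `s_N`
  (`LFSR.GeneratesSeq.succ_of_registerLength_add_le`, cf. Theorem 3).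
* `linearComplexity s N` = `L_N(s)` with `L_N(s) ≤ N`, monotonicity, `L_N(s) = 0` iff the first
  `N` digits vanish, and attainment (`exists_generatesSeq_linearComplexity`).
* `massey_lemma_1` — **Lemma 1**.
* `bmUpdate` — the update (14) with length `max [L, x + L_B]`, its discrepancies
  (`bmUpdate_discrepancy`) and that it generates `s_0, …, s_n` (`bmUpdate_generatesSeq`).
* `massey_theorem_2_eq`, `massey_theorem_2` — **Theorem 2** (both parts), and the all-zero case
  `linearComplexity_succ_of_zeros`.

Not here: the algorithm as a program and its circuit (Fig. 3), Theorem 3 (the set of all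
minimal-length LFSRs; uniqueness iff `2 L_N(s) ≤ N`), §IV–§VI (BCH decoding). The tree's
`Literature/LinearAlgebra/Matrix/WiedemannAlgorithm.lean` treats annihilators and minimal
polynomials of infinite linearly recurrent sequences ([GathenGerhard1999, §12.3]); the present
file is about finite prefixes and register length and shares no declaration with it.
-/

namespace Literature.InformationTheory.Coding.ShiftRegisterSynthesis

open Finset Polynomial

/-- "A general linear feedback shift register (LFSR) of length `L`" with "connection polynomial
`C(D) = 1 + c_1 D + c_2 D^2 + … + c_L D^L` (8) which has degree at most `L`" ("There is no
requirement that `c_L ≠ 0`"). [cite: Massey1969, §II and §III (8)] -/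
structure LFSR (K : Type*) [CommRing K] where
  /-- the length `L` (number of stages) -/
  registerLength : ℕ
  /-- the connection polynomial `C(D)` -/
  connPoly : K[X]
  /-- `C(0) = 1` -/
  connPoly_coeff_zero : connPoly.coeff 0 = 1
  /-- `deg C ≤ L` -/
  connPoly_natDegree_le : connPoly.natDegree ≤ registerLength

section CommRing

variable {K : Type*} [CommRing K]

/-- The sum `∑_{i=0}^{M} C_i s_{j-i}` for a polynomial `C` (with `C_0 s_j` the `i = 0` term);
for an LFSR this is the left side of (2). [cite: Massey1969, §II (2)] -/
def tapSum (C : K[X]) (M : ℕ) (s : ℕ → K) (j : ℕ) : K :=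
  ∑ i ∈ range (M + 1), C.coeff i * s (j - i)

/-- "By way of convention, we take `C(D) = 1` for the LFSR of length `L = 0`"; more generally
the LFSR of length `L` with `C(D) = 1`. [cite: Massey1969, §III (8)] -/
noncomputable def trivialLFSR (L : ℕ) : LFSR K where
  registerLength := L
  connPoly := 1
  connPoly_coeff_zero := by simp
  connPoly_natDegree_le := by simp

/-- The discrepancy of the LFSR at position `j`: `d_j = s_j + ∑_{i=1}^{L} c_i s_{j-i}`
("`d = s_N + ∑_{i=1}^{L} c_i s_{N-i}`", step 2 of the algorithm; "the next discrepancy").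
[cite: Massey1969, §III (11)] -/
def LFSR.nextDiscrepancy (R : LFSR K) (s : ℕ → K) (j : ℕ) : K :=
  tapSum R.connPoly R.registerLength s j

/-- "the LFSR generates the sequence [`s_0, …, s_{N-1}`] if and only if
`s_j + ∑_{i=1}^{L} c_i s_{j-i} = 0`, `j = L, L+1, …, N-1`. (2)" (vacuous for `L ≥ N`: "If
`L ≥ N`, the LFSR always generates the sequence.") [cite: Massey1969, §II (2)] -/
def LFSR.GeneratesSeq (R : LFSR K) (s : ℕ → K) (N : ℕ) : Prop :=
  ∀ j, R.registerLength ≤ j → j < N → R.nextDiscrepancy s j = 0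

/-- `d_j = s_j + ∑_{i=1}^{L} c_i s_{j-i}` (the `i = 0` term is `s_j` since `C(0) = 1`).
[cite: Massey1969, §II (2)] -/
theorem LFSR.nextDiscrepancy_eq (R : LFSR K) (s : ℕ → K) (j : ℕ) :
    R.nextDiscrepancy s j =
      s j + ∑ i ∈ range R.registerLength, R.connPoly.coeff (i + 1) * s (j - (i + 1)) := by
  rw [LFSR.nextDiscrepancy, tapSum, sum_range_succ', R.connPoly_coeff_zero, one_mul, Nat.sub_zero,
    add_comm]

/-- (2) versus the recursion (1): the LFSR generates `s_0, …, s_{N-1}` iff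
`s_j = -∑_{i=1}^{L} c_i s_{j-i}` for `L ≤ j ≤ N - 1`. [cite: Massey1969, §II (1)–(2)] -/
theorem LFSR.generatesSeq_iff_recursion (R : LFSR K) (s : ℕ → K) (N : ℕ) :
    R.GeneratesSeq s N ↔
      ∀ j, R.registerLength ≤ j → j < N →
        s j = -∑ i ∈ range R.registerLength, R.connPoly.coeff (i + 1) * s (j - (i + 1)) := by
  simp only [LFSR.GeneratesSeq, LFSR.nextDiscrepancy_eq, add_eq_zero_iff_eq_neg]

/-- "If `L ≥ N`, the LFSR always generates the sequence." [cite: Massey1969, §II] -/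
theorem LFSR.generatesSeq_of_le_registerLength (R : LFSR K) (s : ℕ → K) {N : ℕ}
    (h : N ≤ R.registerLength) :
    R.GeneratesSeq s N :=
  fun _ hj hjN => absurd (hj.trans_lt hjN) (not_lt.mpr h)

/-- Generating the first `N` digits implies generating the first `M ≤ N`.
[cite: Massey1969, §II (2)] -/
theorem LFSR.GeneratesSeq.shorten {R : LFSR K} {s : ℕ → K} {M N : ℕ} (h : R.GeneratesSeq s N)
    (hMN : M ≤ N) : R.GeneratesSeq s M :=
  fun j hj hjM => h j hj (hjM.trans_le hMN)

/-- Generating `s_0, …, s_N` = generating `s_0, …, s_{N-1}` and (if `L ≤ N`) zero discrepancy at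
`N`. [cite: Massey1969, §III (11)] -/
theorem LFSR.generatesSeq_succ_iff (R : LFSR K) (s : ℕ → K) (N : ℕ) :
    R.GeneratesSeq s (N + 1) ↔
      R.GeneratesSeq s N ∧ (R.registerLength ≤ N → R.nextDiscrepancy s N = 0) := by
  constructor
  · exact fun h => ⟨h.shorten N.le_succ, fun hL => h N hL N.lt_succ_self⟩
  · rintro ⟨h, hN⟩ j hj hjN
    rcases Nat.lt_succ_iff_lt_or_eq.mp hjN with hlt | rfl
    · exact h j hj hlt
    · exact hN hj

/-- An LFSR that generates `s_0, …, s_{N-1}` but not `s_0, …, s_N` has `L ≤ N` and nonzero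
discrepancy `d_N ≠ 0`. [cite: Massey1969, §III (11)] -/
theorem LFSR.registerLength_le_of_not_generatesSeq_succ {R : LFSR K} {s : ℕ → K} {N : ℕ}
    (hR : R.GeneratesSeq s N) (hRn : ¬ R.GeneratesSeq s (N + 1)) :
    R.registerLength ≤ N ∧ R.nextDiscrepancy s N ≠ 0 := by
  rw [LFSR.generatesSeq_succ_iff] at hRn
  push Not at hRn
  exact hRn hR

/-- **Theorem 1** (Massey 1969). "If some LFSR of length `L` generates the sequence
`s_0, s_1, …, s_{N-1}` but not the sequence `s_0, s_1, …, s_{N-1}, s_N`, then any LFSR that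
generates the latter sequence has length `L'`, satisfying `L' ≥ N + 1 - L`. (3)" Stated as
`N + 1 ≤ L + L'`; valid over any commutative ring. [cite: Massey1969, Theorem 1] -/
theorem massey_theorem_1 {R R' : LFSR K} {s : ℕ → K} {N : ℕ} (hR : R.GeneratesSeq s N)
    (hRn : ¬ R.GeneratesSeq s (N + 1)) (hR' : R'.GeneratesSeq s (N + 1)) :
    N + 1 ≤ R.registerLength + R'.registerLength := by
  obtain ⟨hL, hd⟩ := LFSR.registerLength_le_of_not_generatesSeq_succ hR hRn
  by_contra hlt
  push Not at hlt
  apply hd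
  -- the double sum `∑_{i ≤ L} ∑_{k ≤ L'} c_i c'_k s_{N-i-k}`, summed by rows and by columns
  have T1 : ∑ i ∈ range (R.registerLength + 1), ∑ k ∈ range (R'.registerLength + 1),
      R.connPoly.coeff i * (R'.connPoly.coeff k * s (N - i - k)) = 0 := by
    refine Finset.sum_eq_zero fun i hi => ?_
    rw [Finset.mem_range] at hi
    have h := hR' (N - i) (by omega) (by omega)
    rw [LFSR.nextDiscrepancy, tapSum] at h
    rw [← Finset.mul_sum, h, mul_zero]
  have T2 : ∑ i ∈ range (R.registerLength + 1), ∑ k ∈ range (R'.registerLength + 1),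
      R.connPoly.coeff i * (R'.connPoly.coeff k * s (N - i - k)) = R.nextDiscrepancy s N := by
    rw [Finset.sum_comm, Finset.sum_range_succ', R'.connPoly_coeff_zero]
    have hcol : ∀ k ∈ range R'.registerLength, ∑ i ∈ range (R.registerLength + 1),
        R.connPoly.coeff i * (R'.connPoly.coeff (k + 1) * s (N - i - (k + 1))) = 0 := by
      intro k hk
      rw [Finset.mem_range] at hk
      have h := hR (N - (k + 1)) (by omega) (by omega)
      rw [LFSR.nextDiscrepancy, tapSum] at h
      calc ∑ i ∈ range (R.registerLength + 1),
            R.connPoly.coeff i * (R'.connPoly.coeff (k + 1) * s (N - i - (k + 1)))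
          = R'.connPoly.coeff (k + 1) *
              ∑ i ∈ range (R.registerLength + 1), R.connPoly.coeff i * s (N - (k + 1) - i) := by
            rw [Finset.mul_sum]
            refine Finset.sum_congr rfl fun i _ => ?_
            rw [Nat.sub_right_comm]
            ring
        _ = 0 := by rw [h, mul_zero]
    rw [Finset.sum_eq_zero hcol, zero_add, LFSR.nextDiscrepancy, tapSum]
    refine Finset.sum_congr rfl fun i _ => ?_
    rw [one_mul, Nat.sub_zero]
  rw [← T2]
  exact T1

/-- A consequence of Theorem 1 (towards Theorem 3, "the minimal-length LFSR is unique if and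
only if `2 L_N(s) ≤ N`"): two LFSRs with `L + L' ≤ N` that both generate `s_0, …, s_{N-1}`
predict the same next digit — if one of them generates `s_0, …, s_N`, so does the other.
[cite: Massey1969, Theorem 1 (consequence, cf. Theorem 3)] -/
theorem LFSR.GeneratesSeq.succ_of_registerLength_add_le {R R' : LFSR K} {s : ℕ → K} {N : ℕ}
    (hR : R.GeneratesSeq s (N + 1)) (hR' : R'.GeneratesSeq s N)
    (hlen : R.registerLength + R'.registerLength ≤ N) : R'.GeneratesSeq s (N + 1) := by
  by_contra h
  have := massey_theorem_1 hR' h hR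
  omega

/-! ## The linear complexity profile `L_N(s)` -/

/-- "We define `L_N(s)` as the minimum of the lengths of all the LFSR's that generate
`s_0, s_1, …, s_{N-1}`." [cite: Massey1969, §II (L_N(s))] -/
noncomputable def linearComplexity (s : ℕ → K) (N : ℕ) : ℕ :=
  sInf {L | ∃ R : LFSR K, R.registerLength = L ∧ R.GeneratesSeq s N}

/-- The minimum `L_N(s)` is attained by some LFSR. [cite: Massey1969, §II (L_N(s))] -/
theorem exists_generatesSeq_linearComplexity (s : ℕ → K) (N : ℕ) :
    ∃ R : LFSR K, R.registerLength = linearComplexity s N ∧ R.GeneratesSeq s N :=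
  Nat.sInf_mem (s := {L | ∃ R : LFSR K, R.registerLength = L ∧ R.GeneratesSeq s N})
    ⟨N, trivialLFSR N, rfl, (trivialLFSR N).generatesSeq_of_le_registerLength s le_rfl⟩

/-- `L_N(s) ≤ L` for every LFSR of length `L` generating `s_0, …, s_{N-1}`.
[cite: Massey1969, §II (L_N(s))] -/
theorem linearComplexity_le_registerLength {R : LFSR K} {s : ℕ → K} {N : ℕ}
    (h : R.GeneratesSeq s N) :
    linearComplexity s N ≤ R.registerLength :=
  Nat.sInf_le ⟨R, rfl, h⟩

/-- "By our earlier remarks, `L_N(s) ≤ N`." [cite: Massey1969, §II (L_N(s) ≤ N)] -/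
theorem linearComplexity_le (s : ℕ → K) (N : ℕ) : linearComplexity s N ≤ N :=
  linearComplexity_le_registerLength ((trivialLFSR N).generatesSeq_of_le_registerLength s le_rfl)

/-- "`L_N(s)` must be monotonically nondecreasing with increasing `N`."
[cite: Massey1969, §II (monotonicity of L_N(s))] -/
theorem linearComplexity_mono (s : ℕ → K) {M N : ℕ} (h : M ≤ N) :
    linearComplexity s M ≤ linearComplexity s N := by
  obtain ⟨R, hR, hg⟩ := exists_generatesSeq_linearComplexity s N
  rw [← hR]
  exact linearComplexity_le_registerLength (hg.shorten h)

/-- "`L_N(s) = 0` if and only if `s_0, s_1, …, s_{N-1}` are all zeros."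
[cite: Massey1969, §II (L_N(s) = 0)] -/
theorem linearComplexity_eq_zero_iff (s : ℕ → K) (N : ℕ) :
    linearComplexity s N = 0 ↔ ∀ j < N, s j = 0 := by
  constructor
  · intro h0 j hj
    obtain ⟨R, hR, hg⟩ := exists_generatesSeq_linearComplexity s N
    rw [h0] at hR
    have := hg j (by omega) hj
    rw [LFSR.nextDiscrepancy, tapSum, hR, zero_add, Finset.sum_range_one, R.connPoly_coeff_zero,
      one_mul, Nat.sub_zero] at this
    exact this
  · intro h
    refine Nat.le_zero.mp (linearComplexity_le_registerLength (R := trivialLFSR 0) fun j _ hj => ?_)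
    rw [LFSR.nextDiscrepancy, tapSum]
    simp [trivialLFSR, h j hj]

/-- **Lemma 1** (Massey 1969). "If some LFSR of length `L_N(s)` generates `s_0, s_1, …, s_{N-1}`
but not `s_0, s_1, …, s_{N-1}, s_N`, then `L_{N+1}(s) ≥ max [L_N(s), N + 1 - L_N(s)]`."
[cite: Massey1969, Lemma 1] -/
theorem massey_lemma_1 {R : LFSR K} {s : ℕ → K} {N : ℕ}
    (hlen : R.registerLength = linearComplexity s N)
    (hR : R.GeneratesSeq s N) (hRn : ¬ R.GeneratesSeq s (N + 1)) :
    max (linearComplexity s N) (N + 1 - linearComplexity s N) ≤ linearComplexity s (N + 1) := by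
  refine max_le (linearComplexity_mono s N.le_succ) ?_
  obtain ⟨R', hR', hg'⟩ := exists_generatesSeq_linearComplexity s (N + 1)
  have := massey_theorem_1 hR hRn hg'
  omega

/-- **Theorem 2**, first part (Massey 1969). "If some LFSR of length `L_N(s)`, which generates
`s_0, s_1, …, s_{N-1}`, also generates `s_0, s_1, …, s_{N-1}, s_N`, then `L_{N+1}(s) = L_N(s)`."
[cite: Massey1969, Theorem 2] -/
theorem massey_theorem_2_eq {R : LFSR K} {s : ℕ → K} {N : ℕ}
    (hlen : R.registerLength = linearComplexity s N) (hR : R.GeneratesSeq s (N + 1)) :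
    linearComplexity s (N + 1) = linearComplexity s N :=
  le_antisymm (hlen ▸ linearComplexity_le_registerLength hR) (linearComplexity_mono s N.le_succ)

/-! ## Sums against the connection polynomial (linearity and shifts) -/

/-- Extending the summation range past `deg C` does not change the sum.
[cite: Massey1969, §III (14)–(15)] -/
theorem tapSum_eq_of_natDegree_le {C : K[X]} {L M : ℕ} (hC : C.natDegree ≤ L) (hLM : L ≤ M)
    (s : ℕ → K) (j : ℕ) : tapSum C M s j = tapSum C L s j := by
  rw [tapSum, tapSum, ← Finset.sum_range_add_sum_Ico _ (show L + 1 ≤ M + 1 by omega)]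
  have : ∑ i ∈ Ico (L + 1) (M + 1), C.coeff i * s (j - i) = 0 :=
    Finset.sum_eq_zero fun i hi => by
      rw [Finset.mem_Ico] at hi
      rw [coeff_eq_zero_of_natDegree_lt (by omega), zero_mul]
  rw [this, add_zero]

/-- `tapSum` is additive/subtractive in the polynomial. [cite: Massey1969, §III (14)] -/
theorem tapSum_sub (C₁ C₂ : K[X]) (M : ℕ) (s : ℕ → K) (j : ℕ) :
    tapSum (C₁ - C₂) M s j = tapSum C₁ M s j - tapSum C₂ M s j := by
  simp only [tapSum, coeff_sub, sub_mul, Finset.sum_sub_distrib]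

/-- `tapSum` is homogeneous in the polynomial. [cite: Massey1969, §III (14)] -/
theorem tapSum_C_mul (a : K) (C₀ : K[X]) (M : ℕ) (s : ℕ → K) (j : ℕ) :
    tapSum (C a * C₀) M s j = a * tapSum C₀ M s j := by
  simp only [tapSum, coeff_C_mul, mul_assoc, Finset.mul_sum]

/-- Multiplying the connection polynomial by `D^x` shifts the sum by `x` positions.
[cite: Massey1969, §III (14)] -/
theorem tapSum_X_pow_mul (C₀ : K[X]) {x M : ℕ} (hxM : x ≤ M) (s : ℕ → K) (j : ℕ) :
    tapSum (X ^ x * C₀) M s j = tapSum C₀ (M - x) s (j - x) := by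
  rw [tapSum, tapSum, ← Finset.sum_range_add_sum_Ico _ (show x ≤ M + 1 by omega)]
  have h0 : ∑ i ∈ range x, (X ^ x * C₀).coeff i * s (j - i) = 0 :=
    Finset.sum_eq_zero fun i hi => by
      rw [Finset.mem_range] at hi
      rw [coeff_X_pow_mul', if_neg (by omega), zero_mul]
  rw [h0, zero_add, Finset.sum_Ico_eq_sum_range, show M + 1 - x = M - x + 1 by omega]
  refine Finset.sum_congr rfl fun k _ => ?_
  rw [coeff_X_pow_mul', if_pos (Nat.le_add_right x k), Nat.add_sub_cancel_left, Nat.sub_sub]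

end CommRing

/-! ## The update rule (14) and Theorem 2 (over a field) -/

section Field

variable {K : Type*} [Field K]

/-- Massey's update "`C(D) = C^{(n)}(D) - d_n d_m^{-1} D^{n-m} C^{(m)}(D)` (14)", "an allowable
connection polynomial for a LFSR of length" `max [L_n, (n - m) + L_m]`: here for an LFSR `R`
(playing `C^{(n)}`, discrepancy `d`), an LFSR `B` (playing `C^{(m)}`, discrepancy `b`) and a
shift `x = n - m > 0`. [cite: Massey1969, §III (14)] -/
noncomputable def bmUpdate (R B : LFSR K) (d b : K) (x : ℕ) (hx : 0 < x) : LFSR K where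
  registerLength := max R.registerLength (x + B.registerLength)
  connPoly := R.connPoly - C (d * b⁻¹) * X ^ x * B.connPoly
  connPoly_coeff_zero := by
    rw [coeff_sub, mul_assoc, coeff_C_mul, coeff_X_pow_mul', if_neg (by omega), mul_zero,
      sub_zero, R.connPoly_coeff_zero]
  connPoly_natDegree_le := by
    refine (natDegree_sub_le _ _).trans (max_le_max R.connPoly_natDegree_le ?_)
    calc (C (d * b⁻¹) * X ^ x * B.connPoly).natDegree
        ≤ (C (d * b⁻¹) * X ^ x).natDegree + B.connPoly.natDegree := natDegree_mul_le
      _ ≤ x + B.registerLength :=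
          add_le_add ((natDegree_C_mul_le _ _).trans (natDegree_X_pow_le x)) B.connPoly_natDegree_le

/-- The length of the updated LFSR is `max [L, x + L_B]` ((15) before using (13)).
[cite: Massey1969, §III (15)] -/
theorem bmUpdate_registerLength (R B : LFSR K) (d b : K) (x : ℕ) (hx : 0 < x) :
    (bmUpdate R B d b x hx).registerLength = max R.registerLength (x + B.registerLength) := rfl

/-- The discrepancies of the updated LFSR: `d'_j = d^{(R)}_j - d b^{-1} d^{(B)}_{j-x}` (the
display after (15): "`s_j + ∑ c_i s_{j-i} = s_j + ∑ c_i^{(n)} s_{j-i} - d_n d_m^{-1} [ … ]`").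
[cite: Massey1969, §III (14)–(15)] -/
theorem bmUpdate_discrepancy (R B : LFSR K) (d b : K) (x : ℕ) (hx : 0 < x) (s : ℕ → K)
    (j : ℕ) :
    (bmUpdate R B d b x hx).nextDiscrepancy s j =
      R.nextDiscrepancy s j - d * b⁻¹ * B.nextDiscrepancy s (j - x) := by
  have hL : R.registerLength ≤ max R.registerLength (x + B.registerLength) := le_max_left _ _
  have hB : B.registerLength ≤ max R.registerLength (x + B.registerLength) - x := by omega
  rw [LFSR.nextDiscrepancy, bmUpdate_registerLength]
  change tapSum (R.connPoly - C (d * b⁻¹) * X ^ x * B.connPoly) _ s j = _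
  rw [tapSum_sub, mul_assoc, tapSum_C_mul, tapSum_X_pow_mul _ (by omega),
    tapSum_eq_of_natDegree_le R.connPoly_natDegree_le hL,
    tapSum_eq_of_natDegree_le B.connPoly_natDegree_le hB]
  rfl

/-- The updated LFSR generates `s_0, …, s_n`: if `B` generates `s_0, …, s_{m-1}` with discrepancy
`d_m ≠ 0` at `m < n` and `R` generates `s_0, …, s_{n-1}` with discrepancy `d_n` at `n`, then
`C(D) = C^{(n)}(D) - d_n d_m^{-1} D^{n-m} C^{(m)}(D)` "is a valid next choice for `C^{(n+1)}(D)`"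
("it follows from (2) that the LFSR of length `L` with connection polynomial `C(D)` generates the
`n + 1` digits `s_0, s_1, …, s_n`"). [cite: Massey1969, §III (14)–(15)] -/
theorem bmUpdate_generatesSeq {R B : LFSR K} {s : ℕ → K} {m n : ℕ} (hmn : m < n)
    (hB : B.GeneratesSeq s m) (hb : B.nextDiscrepancy s m ≠ 0) (hR : R.GeneratesSeq s n) :
    (bmUpdate R B (R.nextDiscrepancy s n) (B.nextDiscrepancy s m) (n - m) (by omega)).GeneratesSeq s
      (n + 1) := by
  intro j hj hjn
  rw [bmUpdate_registerLength] at hj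
  rw [bmUpdate_discrepancy]
  rcases Nat.lt_succ_iff_lt_or_eq.mp hjn with hlt | heq
  · rw [hR j (by omega) hlt, hB (j - (n - m)) (by omega) (by omega), mul_zero, sub_zero]
  · rw [heq, show n - (n - m) = m by omega, mul_assoc, inv_mul_cancel₀ hb, mul_one, sub_self]

/-- **Theorem 2**, second part (Massey 1969; the correctness core of the Berlekamp–Massey
algorithm). "if some LFSR of length `L_N(s)` that generates `s_0, s_1, …, s_{N-1}` fails to
generate `s_0, s_1, …, s_{N-1}, s_N`, then `L_{N+1}(s) = max [L_N(s), N + 1 - L_N(s)]`."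
The proof is Massey's induction: `≥` is Lemma 1; for `≤`, with `m` "the sequence length before
the last length change", the update (14) has length (15). [cite: Massey1969, Theorem 2] -/
theorem massey_theorem_2 {s : ℕ → K} {N : ℕ} {R : LFSR K}
    (hlen : R.registerLength = linearComplexity s N)
    (hR : R.GeneratesSeq s N) (hRn : ¬ R.GeneratesSeq s (N + 1)) :
    linearComplexity s (N + 1) = max (linearComplexity s N) (N + 1 - linearComplexity s N) := by
  classical
  induction N using Nat.strong_induction_on generalizing R with
  | _ N ih =>
    refine le_antisymm ?_ (massey_lemma_1 hlen hR hRn)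
    obtain ⟨hLN, hdN⟩ := LFSR.registerLength_le_of_not_generatesSeq_succ hR hRn
    by_cases h0 : linearComplexity s N = 0
    · rw [h0]
      exact (linearComplexity_le s (N + 1)).trans (by omega)
    -- `m` = "the sequence length before the last length change"
    have hN : 0 < N := by
      rcases Nat.eq_zero_or_pos N with rfl | hN
      · exact absurd (Nat.le_zero.mp (linearComplexity_le s 0)) h0
      · exact hN
    have hN1 : linearComplexity s (N - 1 + 1) = linearComplexity s N := by
      rw [Nat.sub_add_cancel hN]
    have hex : ∃ m, linearComplexity s (m + 1) = linearComplexity s N := ⟨N - 1, hN1⟩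
    obtain ⟨m, hm, hmin⟩ : ∃ m, linearComplexity s (m + 1) = linearComplexity s N ∧
        ∀ m' < m, linearComplexity s (m' + 1) ≠ linearComplexity s N :=
      ⟨Nat.find hex, Nat.find_spec hex, fun m' h => Nat.find_min hex h⟩
    have hmN : m < N := by
      by_contra hge
      exact hmin (N - 1) (by omega) hN1
    have hlt : linearComplexity s m < linearComplexity s N := by
      rcases Nat.eq_zero_or_pos m with hm0 | hm0
      · rw [hm0]
        have := linearComplexity_le s 0
        omega
      · have hne := hmin (m - 1) (by omega)
        rw [Nat.sub_add_cancel hm0] at hne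
        have hle : linearComplexity s m ≤ linearComplexity s N := by
          rw [← hm]
          exact linearComplexity_mono s m.le_succ
        omega
    -- a minimal LFSR `B` for `s_0, …, s_{m-1}`; it fails at `m` since the length changes there
    obtain ⟨B, hBlen, hB⟩ := exists_generatesSeq_linearComplexity s m
    have hBn : ¬ B.GeneratesSeq s (m + 1) := fun h =>
      absurd (linearComplexity_le_registerLength h) (by rw [hBlen, hm]; exact not_le.mpr hlt)
    obtain ⟨hBm, hb⟩ := LFSR.registerLength_le_of_not_generatesSeq_succ hB hBn
    -- induction hypothesis at `m < N`: equality in Lemma 1, hence (13) `L_N = m + 1 - L_m`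
    have h13 := ih m hmN hBlen hB hBn
    -- the update (14) generates `s_0, …, s_N` and has length (15)
    have hU := bmUpdate_generatesSeq hmN hB hb hR
    refine (linearComplexity_le_registerLength hU).trans (le_of_eq ?_)
    rw [bmUpdate_registerLength, hlen, hBlen]
    omega

/-- "When `s_0, s_1, …, s_{N-1}` are all zeros but `s_N ≠ 0`, then `L_{N+1}(s) = N + 1` since
any shorter LFSR must be initially loaded with all zeros and thus could generate only further
zeros." [cite: Massey1969, §III] -/
theorem linearComplexity_succ_of_zeros {s : ℕ → K} {N : ℕ} (h0 : ∀ j < N, s j = 0)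
    (hN : s N ≠ 0) : linearComplexity s (N + 1) = N + 1 := by
  have hL : linearComplexity s N = 0 := (linearComplexity_eq_zero_iff s N).mpr h0
  have hR : (trivialLFSR 0 : LFSR K).GeneratesSeq s N := fun j _ hj => by
    rw [LFSR.nextDiscrepancy, tapSum]
    simp [trivialLFSR, h0 j hj]
  have hRn : ¬ (trivialLFSR 0 : LFSR K).GeneratesSeq s (N + 1) := fun h => by
    have := h N (Nat.zero_le N) N.lt_succ_self
    rw [LFSR.nextDiscrepancy, tapSum] at this
    simp [trivialLFSR] at this
    exact hN this
  rw [massey_theorem_2 (R := trivialLFSR 0) (by rw [hL]; rfl) hR hRn, hL]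
  omega

end Field

end Literature.InformationTheory.Coding.ShiftRegisterSynthesis
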